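import Mathlib
import Summits.Ventures.PercRepro2.Defs
import Summits.Ventures.PercRepro2.Independence
import Summits.Ventures.PercRepro2.Harris
import Summits.Ventures.PercRepro2.Exploration
import Summits.Ventures.PercRepro2.FourFunctions
import Summits.Ventures.PercRepro2.Frontier
import Summits.Ventures.PercRepro2.ObsIndependence
import Summits.Ventures.PercRepro2.BHK
import Summits.Ventures.PercRepro2.CoinDefs
import Summits.Ventures.PercRepro2.CoinInduced
import Summits.Ventures.PercRepro2.CoinFrontier

/-!
# The van den Berg–Häggström–Kahn inequality for cluster functionals on MIXED coin systems (blind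
cell PercRepro2, night-2)

Directed BHK (vdBHK 2006, Theorem 1.1 / 1.3, functional form) on a `SameEnds` coin system: for a
root `s`, nonnegative functionals `F₁, F₂` of the forward cluster `S⁺ = {v | s ⇝ v}` that are
monotone for `⊆`, and vertex sets `X, Y`, with `R_X = {s ↛ x ∀ x ∈ X}`,

  `E[F₁(S⁺) 1_{R_X}] · E[F₂(S⁺) 1_{R_Y}] ≤ E[(F₁F₂)(S⁺) 1_{R_{X∩Y}}] · P(R_{X∪Y})`.

The case `F_i = 1{A_i ⊆ ·}` is `vdBKC` (`CoinVdBK.lean`); the case `X = Y` says that the forward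
cluster of `s` is positively associated conditionally on `s ↛ X` — directed BHK 1.3 for
ARBITRARY increasing cluster functionals (the `(DARC-fun)` generality of NIGHT2-DARC.md §7.1, and
the functional facts the marker-gate transfer of MINEC-GATE.md §8 needs).  The proof is the cell's
`BHK.lean` (p1) read backwards, exactly as `CoinVdBK.lean` is `VdBKahn.lean` read backwards:
on `R_Z` the forward cluster in `D[U]` is the forward cluster in `D[U ∖ Z]` (`clusterInC_sdiff_eq`,
`SameEnds`), the in-frontier replaces the avoided set `Z`, the tower identity `expect_tower`
(model-free, `ObsIndependence.lean`) and the four functions theorem close the step.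
-/

namespace Summit.Ventures.PercRepro2.Coin

/-! ## Cluster functionals of the forward cluster -/

section ClusterObs

variable {V : Type*} {E : Type*} {R : Type*} {arcs : E → Finset (V × V)} {U : Finset V} {s : V}

/-- The forward cluster of `s` in the whole coin system. -/
def clusterC (arcs : E → Finset (V × V)) (ω : Config E) (s : V) : Set V :=
  {v | Reach arcs ω s v}

/-- The forward cluster of `s` in `D[U]`. -/
def clusterInC (arcs : E → Finset (V × V)) (U : Finset V) (s : V) (ω : Config E) : Set V :=
  clusterC arcs (inducedC arcs (↑U) ω) s

/-- A cluster functional `F : Set V → R` evaluated on the forward cluster of `s` in `D[U]`. -/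
def clusterObsC (arcs : E → Finset (V × V)) (U : Finset V) (s : V) (F : Set V → R) :
    Config E → R :=
  fun ω => F (clusterInC arcs U s ω)

/-- Membership in the cluster in `D[U]`. -/
lemma mem_clusterInC {ω : Config E} {v : V} :
    v ∈ clusterInC arcs U s ω ↔ Reach arcs (inducedC arcs (↑U) ω) s v := Iff.rfl

/-- `clusterObsC` applied. -/
lemma clusterObsC_apply (F : Set V → R) (ω : Config E) :
    clusterObsC arcs U s F ω = F (clusterInC arcs U s ω) := rfl

/-- The forward cluster is monotone in the configuration. -/
lemma clusterC_mono {ω ω' : Config E} (h : ω ≤ ω') (s : V) :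
    clusterC arcs ω s ⊆ clusterC arcs ω' s :=
  fun _ hv => reach_mono h hv

/-- The cluster in `D[U]` is monotone in the configuration. -/
lemma clusterInC_mono {ω ω' : Config E} (h : ω ≤ ω') :
    clusterInC arcs U s ω ⊆ clusterInC arcs U s ω' :=
  clusterC_mono (inducedC_mono h) s

/-- A functional that is monotone on the forward clusters of `s` (for all configurations) is a
monotone observable on every induced coin system. -/
lemma monotone_clusterObsC' [Preorder R] {F : Set V → R}
    (hF : ∀ ω ω' : Config E, clusterC arcs ω s ⊆ clusterC arcs ω' s →
      F (clusterC arcs ω s) ≤ F (clusterC arcs ω' s)) :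
    Monotone (clusterObsC arcs U s F) :=
  fun _ _ h => hF _ _ (clusterInC_mono h)

/-- `clusterObsC` is determined by the coins inside `U`. -/
lemma dependsOn_clusterObsC (F : Set V → R) :
    DependsOn (clusterObsC arcs U s F) (withinC arcs (↑U)) := by
  intro ω ω' h
  simp only [clusterObsC_apply, clusterInC, inducedC_congr h]

/-- `clusterObsC` of a product is the product. -/
lemma clusterObsC_mul [Mul R] (F₁ F₂ : Set V → R) :
    clusterObsC arcs U s (F₁ * F₂) = clusterObsC arcs U s F₁ * clusterObsC arcs U s F₂ := rfl

/-- `clusterObsC` of the constant `1` is `1`. -/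
lemma clusterObsC_one [One R] : clusterObsC arcs U s (fun _ => (1 : R)) = 1 := rfl

/-- On `{s ↛ Z in D[U]}` the forward cluster of `s` in `D[U ∖ Z]` is its cluster in `D[U]`
(`SameEnds`). -/
lemma clusterInC_sdiff_eq [DecidableEq V] (hS : SameEnds arcs) {Z : Finset V} {ω : Config E}
    (hR : ∀ z ∈ Z, ¬ Reach arcs (inducedC arcs (↑U) ω) s z) :
    clusterInC arcs (U \ Z) s ω = clusterInC arcs U s ω := by
  ext x
  simp only [mem_clusterInC]
  exact ⟨reach_mono (inducedC_mono_set (Finset.coe_subset.2 Finset.sdiff_subset) ω),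
    reach_inducedC_sdiff_of_reach hS hR⟩

/-- On the full vertex set the cluster in `D[univ]` is the whole-system cluster. -/
lemma clusterInC_univ [Fintype V] (ω : Config E) :
    clusterInC arcs Finset.univ s ω = clusterC arcs ω s := by
  simp only [clusterInC, Finset.coe_univ, inducedC_univ]

end ClusterObs

/-! ## The inequality on induced coin systems -/

section BHKMain

variable {V : Type*} {E : Type*} [Fintype E] [DecidableEq E] [Fintype V] [DecidableEq V]
  {R : Type*} [CommRing R] [LinearOrder R] [IsStrictOrderedRing R]

omit [Fintype E] [DecidableEq E] [Fintype V] [DecidableEq V] in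
/-- Nonnegativity of `F(S⁺) · 1_A` for a nonnegative functional. -/
lemma clusterObsC_mul_indicator_nonneg (arcs : E → Finset (V × V)) (U : Finset V) (s : V)
    {F : Set V → R} (hF : ∀ ω : Config E, 0 ≤ F (clusterC arcs ω s)) (A : Set (Config E))
    (ω : Config E) : 0 ≤ (clusterObsC arcs U s F * A.indicator (1 : Config E → R)) ω :=
  mul_nonneg (hF _) (Set.indicator_apply_nonneg fun _ => zero_le_one)

omit [Fintype V] [DecidableEq V] in
/-- Monotonicity in the event: `E(F(S⁺) 1_A) ≤ E(F(S⁺) 1_B)` for `A ⊆ B` and `F ≥ 0`. -/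
lemma expect_clusterObsC_mul_indicator_mono {p : E → R} (hp : IsProbVec p)
    (arcs : E → Finset (V × V)) (U : Finset V) (s : V) {F : Set V → R}
    (hF : ∀ ω : Config E, 0 ≤ F (clusterC arcs ω s)) {A B : Set (Config E)} (hAB : A ⊆ B) :
    expect p (clusterObsC arcs U s F * A.indicator 1) ≤
      expect p (clusterObsC arcs U s F * B.indicator 1) := by
  refine expect_mono hp fun ω => ?_
  simp only [Pi.mul_apply]
  refine mul_le_mul_of_nonneg_left ?_ (hF _)
  by_cases h : ω ∈ A
  · rw [Set.indicator_of_mem h, Set.indicator_of_mem (hAB h)]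
  · rw [Set.indicator_of_notMem h]
    exact Set.indicator_apply_nonneg fun _ => zero_le_one

omit [Fintype V] in
/-- The case `X ∩ Y = ∅`: Harris' inequality three times. -/
lemma bhkC_induced_of_inter_eq_empty (p : E → R) (hp : IsProbVec p) (arcs : E → Finset (V × V))
    (s : V) (U : Finset V) {F₁ F₂ : Set V → R}
    (hF₁ : ∀ ω ω' : Config E, clusterC arcs ω s ⊆ clusterC arcs ω' s →
      F₁ (clusterC arcs ω s) ≤ F₁ (clusterC arcs ω' s))
    (hF₂ : ∀ ω ω' : Config E, clusterC arcs ω s ⊆ clusterC arcs ω' s →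
      F₂ (clusterC arcs ω s) ≤ F₂ (clusterC arcs ω' s))
    (hF₁0 : ∀ ω : Config E, 0 ≤ F₁ (clusterC arcs ω s))
    (hF₂0 : ∀ ω : Config E, 0 ≤ F₂ (clusterC arcs ω s)) (X Y : Finset V) (hZ : X ∩ Y = ∅) :
    expect p (clusterObsC arcs U s F₁ * (REventC arcs U s X).indicator 1) *
        expect p (clusterObsC arcs U s F₂ * (REventC arcs U s Y).indicator 1) ≤
      expect p (clusterObsC arcs U s (F₁ * F₂) * (REventC arcs U s (X ∩ Y)).indicator 1) *
        prob p (REventC arcs U s (X ∪ Y)) := by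
  rw [hZ, REventC_empty, Set.indicator_univ, mul_one, REventC_union, clusterObsC_mul]
  have hRX := isLowerSet_REventC arcs U s X
  have hRY := isLowerSet_REventC arcs U s Y
  have h1 := expect_mul_indicator_le_of_isLowerSet hp
    (monotone_clusterObsC' (arcs := arcs) (U := U) (s := s) hF₁) hRX
  have h2 := expect_mul_indicator_le_of_isLowerSet hp
    (monotone_clusterObsC' (arcs := arcs) (U := U) (s := s) hF₂) hRY
  have h3 := expect_mul_expect_le_expect_mul hp
    (monotone_clusterObsC' (arcs := arcs) (U := U) (s := s) hF₁)
    (monotone_clusterObsC' (arcs := arcs) (U := U) (s := s) hF₂)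
  have h4 := prob_mul_prob_le_prob_inter_of_isLowerSet hp hRX hRY
  have n1 : 0 ≤ expect p (clusterObsC arcs U s F₂ * (REventC arcs U s Y).indicator 1) :=
    expect_nonneg hp (clusterObsC_mul_indicator_nonneg arcs U s hF₂0 _)
  have n2 : 0 ≤ expect p (clusterObsC arcs U s F₁) := expect_nonneg hp fun ω => hF₁0 _
  have n3 : 0 ≤ expect p (clusterObsC arcs U s F₁ * clusterObsC arcs U s F₂) :=
    expect_nonneg hp fun ω => mul_nonneg (hF₁0 _) (hF₂0 _)
  calc expect p (clusterObsC arcs U s F₁ * (REventC arcs U s X).indicator 1) *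
        expect p (clusterObsC arcs U s F₂ * (REventC arcs U s Y).indicator 1)
      ≤ (expect p (clusterObsC arcs U s F₁) * prob p (REventC arcs U s X)) *
          (expect p (clusterObsC arcs U s F₂) * prob p (REventC arcs U s Y)) :=
        mul_le_mul h1 h2 n1 (mul_nonneg n2 (prob_nonneg hp _))
    _ = (expect p (clusterObsC arcs U s F₁) * expect p (clusterObsC arcs U s F₂)) *
          (prob p (REventC arcs U s X) * prob p (REventC arcs U s Y)) := by ring
    _ ≤ expect p (clusterObsC arcs U s F₁ * clusterObsC arcs U s F₂) *
          prob p (REventC arcs U s X ∩ REventC arcs U s Y) :=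
        mul_le_mul h3 h4 (mul_nonneg (prob_nonneg hp _) (prob_nonneg hp _)) n3

omit [DecidableEq E] [Fintype V] [LinearOrder R] [IsStrictOrderedRing R] in
/-- **Pointwise transfer to `D[U ∖ Z]`** (`SameEnds`): for `s ∉ Z ⊆ U`,
`F(S⁺_U) · 1_{R^U_{W ∪ Z}} = F(S⁺_{U∖Z}) · 1_{R^{U∖Z}_{W ∪ frontierC}}` configuration by
configuration. -/
lemma clusterObsC_mul_indicator_eq {arcs : E → Finset (V × V)} (hS : SameEnds arcs)
    {U Z : Finset V} (hZU : Z ⊆ U) {s : V} (hsZ : s ∉ Z) (F : Set V → R) (W : Finset V)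
    (ω : Config E) :
    (clusterObsC arcs U s F * (REventC arcs U s (W ∪ Z)).indicator (1 : Config E → R)) ω =
      (clusterObsC arcs (U \ Z) s F *
        (REventC arcs (U \ Z) s (W ∪ frontierC arcs U Z ω)).indicator (1 : Config E → R)) ω := by
  have key := Set.ext_iff.1 (QEventC_inter_REventC_union_eq hS hZU hsZ ∅ W) ω
  simp only [QEventC_empty, Set.univ_inter, Set.mem_setOf_eq] at key
  simp only [Pi.mul_apply]
  by_cases h : ω ∈ REventC arcs U s (W ∪ Z)
  · have hR : ∀ z ∈ Z, ¬ Reach arcs (inducedC arcs (↑U) ω) s z :=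
      fun z hz => h z (Finset.mem_union_right W hz)
    rw [Set.indicator_of_mem h, Set.indicator_of_mem (key.1 h), clusterObsC_apply,
      clusterObsC_apply, clusterInC_sdiff_eq hS hR]
  · rw [Set.indicator_of_notMem h, Set.indicator_of_notMem fun h' => h (key.2 h'), mul_zero,
      mul_zero]

omit [LinearOrder R] [IsStrictOrderedRing R] in
/-- **Domain Markov identity for cluster functionals** (`SameEnds`): for `s ∉ Z ⊆ U`,
`E(F(S⁺_U) 1_{R^U_{W∪Z}}) = ∑_ω weight p ω · E(F(S⁺_{U∖Z}) 1_{R^{U∖Z}_{W ∪ frontierC ω}})`. -/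
theorem expect_clusterObsC_mul_indicator_eq_sum (p : E → R) {arcs : E → Finset (V × V)}
    (hS : SameEnds arcs) {U Z : Finset V} (hZU : Z ⊆ U) {s : V} (hsZ : s ∉ Z) (F : Set V → R)
    (W : Finset V) :
    expect p (clusterObsC arcs U s F * (REventC arcs U s (W ∪ Z)).indicator 1) =
      ∑ ω, weight p ω * expect p (clusterObsC arcs (U \ Z) s F *
        (REventC arcs (U \ Z) s (W ∪ frontierC arcs U Z ω)).indicator 1) := by
  have e : (clusterObsC arcs U s F * (REventC arcs U s (W ∪ Z)).indicator (1 : Config E → R)) =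
      fun ω => (clusterObsC arcs (U \ Z) s F *
        (REventC arcs (U \ Z) s (W ∪ frontierC arcs U Z ω)).indicator (1 : Config E → R)) ω :=
    funext fun ω => clusterObsC_mul_indicator_eq hS hZU hsZ F W ω
  rw [e]
  exact expect_tower p (F₁ := fun _ => intoC arcs (↑Z)) (F₂ := fun _ => withinC arcs (↑(U \ Z)))
    (S := frontierC arcs U Z)
    (Φ := fun T => clusterObsC arcs (U \ Z) s F * (REventC arcs (U \ Z) s (W ∪ T)).indicator 1)
    (fun _ => disjoint_intoC_withinC_sdiff arcs U Z)
    (fun T ω ω' h => by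
      show (frontierC arcs U Z ω = T) = (frontierC arcs U Z ω' = T)
      rw [dependsOn_frontierC arcs U Z h])
    fun T => dependsOn_mul (dependsOn_clusterObsC F)
      (dependsOn_indicator (dependsOn_REventC arcs (U \ Z) s (W ∪ T)))

/-- **Directed van den Berg–Häggström–Kahn on induced coin systems** (functional form, minimal
hypotheses, `SameEnds`): for cluster functionals `F₁, F₂` that are nonnegative and monotone on the
forward clusters of `s`, every vertex set `U` and `X, Y ⊆ U`,
`E(F₁(S⁺_U) 1_{R^U_X}) · E(F₂(S⁺_U) 1_{R^U_Y}) ≤ E((F₁F₂)(S⁺_U) 1_{R^U_{X∩Y}}) · P(R^U_{X∪Y})`. -/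
theorem bhkC_induced' (p : E → R) (hp : IsProbVec p) {arcs : E → Finset (V × V)}
    (hS : SameEnds arcs) (s : V) {F₁ F₂ : Set V → R}
    (hF₁ : ∀ ω ω' : Config E, clusterC arcs ω s ⊆ clusterC arcs ω' s →
      F₁ (clusterC arcs ω s) ≤ F₁ (clusterC arcs ω' s))
    (hF₂ : ∀ ω ω' : Config E, clusterC arcs ω s ⊆ clusterC arcs ω' s →
      F₂ (clusterC arcs ω s) ≤ F₂ (clusterC arcs ω' s))
    (hF₁0 : ∀ ω : Config E, 0 ≤ F₁ (clusterC arcs ω s))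
    (hF₂0 : ∀ ω : Config E, 0 ≤ F₂ (clusterC arcs ω s)) (U : Finset V) :
    ∀ X Y : Finset V, X ⊆ U → Y ⊆ U →
      expect p (clusterObsC arcs U s F₁ * (REventC arcs U s X).indicator 1) *
          expect p (clusterObsC arcs U s F₂ * (REventC arcs U s Y).indicator 1) ≤
        expect p (clusterObsC arcs U s (F₁ * F₂) * (REventC arcs U s (X ∩ Y)).indicator 1) *
          prob p (REventC arcs U s (X ∪ Y)) := by
  have hF0 : ∀ ω : Config E, 0 ≤ (F₁ * F₂) (clusterC arcs ω s) :=
    fun ω => mul_nonneg (hF₁0 ω) (hF₂0 ω)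
  induction U using Finset.strongInduction with
  | H U ih =>
  intro X Y hX hY
  by_cases hZ : X ∩ Y = ∅
  · exact bhkC_induced_of_inter_eq_empty p hp arcs s U hF₁ hF₂ hF₁0 hF₂0 X Y hZ
  -- the exploration step: `Z = X ∩ Y ≠ ∅`
  set Z := X ∩ Y with hZdef
  have hZX : Z ⊆ X := Finset.inter_subset_left
  have hZY : Z ⊆ Y := Finset.inter_subset_right
  have hZU : Z ⊆ U := hZX.trans hX
  by_cases hsZ : s ∈ Z
  · -- `s ∈ X`: the left side vanishes
    have h0 : expect p (clusterObsC arcs U s F₁ * (REventC arcs U s X).indicator 1) = 0 := by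
      rw [REventC_eq_empty_of_mem arcs U (hZX hsZ)]
      simp [expect]
    rw [h0, zero_mul]
    exact mul_nonneg (expect_nonneg hp (clusterObsC_mul_indicator_nonneg arcs U s hF0 _))
      (prob_nonneg hp _)
  have hU' : U \ Z ⊂ U := Finset.sdiff_ssubset hZU (Finset.nonempty_iff_ne_empty.2 hZ)
  -- the four terms as sums over configurations (domain Markov identity)
  have e1 : expect p (clusterObsC arcs U s F₁ * (REventC arcs U s X).indicator 1) =
      ∑ ω, weight p ω * expect p (clusterObsC arcs (U \ Z) s F₁ *
        (REventC arcs (U \ Z) s ((X \ Z) ∪ frontierC arcs U Z ω)).indicator 1) := by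
    rw [← expect_clusterObsC_mul_indicator_eq_sum p hS hZU hsZ F₁ (X \ Z),
      Finset.sdiff_union_of_subset hZX]
  have e2 : expect p (clusterObsC arcs U s F₂ * (REventC arcs U s Y).indicator 1) =
      ∑ ω, weight p ω * expect p (clusterObsC arcs (U \ Z) s F₂ *
        (REventC arcs (U \ Z) s ((Y \ Z) ∪ frontierC arcs U Z ω)).indicator 1) := by
    rw [← expect_clusterObsC_mul_indicator_eq_sum p hS hZU hsZ F₂ (Y \ Z),
      Finset.sdiff_union_of_subset hZY]
  have e3 : expect p (clusterObsC arcs U s (F₁ * F₂) * (REventC arcs U s Z).indicator 1) =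
      ∑ ω, weight p ω * expect p (clusterObsC arcs (U \ Z) s (F₁ * F₂) *
        (REventC arcs (U \ Z) s (∅ ∪ frontierC arcs U Z ω)).indicator 1) := by
    rw [← expect_clusterObsC_mul_indicator_eq_sum p hS hZU hsZ (F₁ * F₂) ∅, Finset.empty_union]
  have e4 : prob p (REventC arcs U s (X ∪ Y)) =
      ∑ ω, weight p ω * expect p (clusterObsC arcs (U \ Z) s (fun _ => 1) *
        (REventC arcs (U \ Z) s (((X \ Z) ∪ (Y \ Z)) ∪ frontierC arcs U Z ω)).indicator 1) := by
    rw [← expect_clusterObsC_mul_indicator_eq_sum p hS hZU hsZ (fun _ => 1) ((X \ Z) ∪ (Y \ Z)),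
      clusterObsC_one, one_mul, ← prob_eq_expect_indicator, ← Finset.union_sdiff_distrib,
      Finset.sdiff_union_of_subset (hZX.trans Finset.subset_union_left)]
  rw [e1, e2, e3, e4]
  -- the four functions theorem on the lattice `Config E`
  refine four_functions_theorem_univ
    (fun ω => weight p ω * expect p (clusterObsC arcs (U \ Z) s F₁ *
      (REventC arcs (U \ Z) s ((X \ Z) ∪ frontierC arcs U Z ω)).indicator 1))
    (fun ω => weight p ω * expect p (clusterObsC arcs (U \ Z) s F₂ *
      (REventC arcs (U \ Z) s ((Y \ Z) ∪ frontierC arcs U Z ω)).indicator 1))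
    (fun ω => weight p ω * expect p (clusterObsC arcs (U \ Z) s (F₁ * F₂) *
      (REventC arcs (U \ Z) s (∅ ∪ frontierC arcs U Z ω)).indicator 1))
    (fun ω => weight p ω * expect p (clusterObsC arcs (U \ Z) s (fun _ => 1) *
      (REventC arcs (U \ Z) s (((X \ Z) ∪ (Y \ Z)) ∪ frontierC arcs U Z ω)).indicator 1))
    (fun ω => mul_nonneg (weight_nonneg hp ω)
      (expect_nonneg hp (clusterObsC_mul_indicator_nonneg arcs _ s hF₁0 _)))
    (fun ω => mul_nonneg (weight_nonneg hp ω)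
      (expect_nonneg hp (clusterObsC_mul_indicator_nonneg arcs _ s hF₂0 _)))
    (fun ω => mul_nonneg (weight_nonneg hp ω)
      (expect_nonneg hp (clusterObsC_mul_indicator_nonneg arcs _ s hF0 _)))
    (fun ω => mul_nonneg (weight_nonneg hp ω)
      (expect_nonneg hp (clusterObsC_mul_indicator_nonneg arcs _ s (fun _ => zero_le_one) _))) ?_
  intro ω ω'
  -- induction hypothesis on `U ∖ Z` with the in-frontiers added to the avoided sets
  have hX'' : (X \ Z) ∪ frontierC arcs U Z ω ⊆ U \ Z :=
    Finset.union_subset (Finset.sdiff_subset_sdiff hX (le_refl Z)) (frontierC_subset ω)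
  have hY'' : (Y \ Z) ∪ frontierC arcs U Z ω' ⊆ U \ Z :=
    Finset.union_subset (Finset.sdiff_subset_sdiff hY (le_refl Z)) (frontierC_subset ω')
  have hIH := ih (U \ Z) hU' ((X \ Z) ∪ frontierC arcs U Z ω) ((Y \ Z) ∪ frontierC arcs U Z ω')
    hX'' hY''
  -- `S(ω ⊓ ω') ⊆ S(ω) ∩ S(ω') ⊆ X'' ∩ Y''`
  have h3 : expect p (clusterObsC arcs (U \ Z) s (F₁ * F₂) * (REventC arcs (U \ Z) s
      (((X \ Z) ∪ frontierC arcs U Z ω) ∩ ((Y \ Z) ∪ frontierC arcs U Z ω'))).indicator 1) ≤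
      expect p (clusterObsC arcs (U \ Z) s (F₁ * F₂) *
        (REventC arcs (U \ Z) s (∅ ∪ frontierC arcs U Z (ω ⊓ ω'))).indicator 1) := by
    refine expect_clusterObsC_mul_indicator_mono hp arcs _ s hF0 (REventC_anti _ _ _ ?_)
    rw [Finset.empty_union]
    exact (frontierC_inf_subset ω ω').trans
      (Finset.inter_subset_inter Finset.subset_union_right Finset.subset_union_right)
  -- `X'' ∪ Y'' = (X' ∪ Y') ∪ S(ω ⊔ ω')`
  have h4 : prob p (REventC arcs (U \ Z) s
      (((X \ Z) ∪ frontierC arcs U Z ω) ∪ ((Y \ Z) ∪ frontierC arcs U Z ω'))) =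
      expect p (clusterObsC arcs (U \ Z) s (fun _ => 1) *
        (REventC arcs (U \ Z) s (((X \ Z) ∪ (Y \ Z)) ∪
          frontierC arcs U Z (ω ⊔ ω'))).indicator 1) := by
    rw [clusterObsC_one, one_mul, ← prob_eq_expect_indicator, frontierC_sup]
    congr 2
    ext x
    simp only [Finset.mem_union]
    tauto
  have n3 : 0 ≤ expect p (clusterObsC arcs (U \ Z) s (F₁ * F₂) *
      (REventC arcs (U \ Z) s (∅ ∪ frontierC arcs U Z (ω ⊓ ω'))).indicator 1) :=
    expect_nonneg hp (clusterObsC_mul_indicator_nonneg arcs _ s hF0 _)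
  have n4 : 0 ≤ prob p (REventC arcs (U \ Z) s
      (((X \ Z) ∪ frontierC arcs U Z ω) ∪ ((Y \ Z) ∪ frontierC arcs U Z ω'))) := prob_nonneg hp _
  calc weight p ω * expect p (clusterObsC arcs (U \ Z) s F₁ *
          (REventC arcs (U \ Z) s ((X \ Z) ∪ frontierC arcs U Z ω)).indicator 1) *
        (weight p ω' * expect p (clusterObsC arcs (U \ Z) s F₂ *
          (REventC arcs (U \ Z) s ((Y \ Z) ∪ frontierC arcs U Z ω')).indicator 1))
      = (weight p ω * weight p ω') *
          (expect p (clusterObsC arcs (U \ Z) s F₁ *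
            (REventC arcs (U \ Z) s ((X \ Z) ∪ frontierC arcs U Z ω)).indicator 1) *
          expect p (clusterObsC arcs (U \ Z) s F₂ *
            (REventC arcs (U \ Z) s ((Y \ Z) ∪ frontierC arcs U Z ω')).indicator 1)) := by ring
    _ ≤ (weight p ω * weight p ω') *
          (expect p (clusterObsC arcs (U \ Z) s (F₁ * F₂) *
            (REventC arcs (U \ Z) s (∅ ∪ frontierC arcs U Z (ω ⊓ ω'))).indicator 1) *
          expect p (clusterObsC arcs (U \ Z) s (fun _ => 1) *
            (REventC arcs (U \ Z) s (((X \ Z) ∪ (Y \ Z)) ∪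
              frontierC arcs U Z (ω ⊔ ω'))).indicator 1)) :=
        mul_le_mul_of_nonneg_left (hIH.trans (mul_le_mul h3 (le_of_eq h4) n4 n3))
          (mul_nonneg (weight_nonneg hp ω) (weight_nonneg hp ω'))
    _ = weight p (ω ⊓ ω') * expect p (clusterObsC arcs (U \ Z) s (F₁ * F₂) *
          (REventC arcs (U \ Z) s (∅ ∪ frontierC arcs U Z (ω ⊓ ω'))).indicator 1) *
        (weight p (ω ⊔ ω') * expect p (clusterObsC arcs (U \ Z) s (fun _ => 1) *
          (REventC arcs (U \ Z) s (((X \ Z) ∪ (Y \ Z)) ∪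
            frontierC arcs U Z (ω ⊔ ω'))).indicator 1)) := by
        rw [← weight_inf_mul_weight_sup p ω ω']
        ring

/-- **Directed van den Berg–Häggström–Kahn on induced coin systems** (functional form,
`SameEnds`) for nonnegative monotone cluster functionals `F₁, F₂`. -/
theorem bhkC_induced (p : E → R) (hp : IsProbVec p) {arcs : E → Finset (V × V)}
    (hS : SameEnds arcs) (s : V) {F₁ F₂ : Set V → R} (hF₁ : Monotone F₁) (hF₂ : Monotone F₂)
    (hF₁0 : ∀ S, 0 ≤ F₁ S) (hF₂0 : ∀ S, 0 ≤ F₂ S) (U : Finset V) :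
    ∀ X Y : Finset V, X ⊆ U → Y ⊆ U →
      expect p (clusterObsC arcs U s F₁ * (REventC arcs U s X).indicator 1) *
          expect p (clusterObsC arcs U s F₂ * (REventC arcs U s Y).indicator 1) ≤
        expect p (clusterObsC arcs U s (F₁ * F₂) * (REventC arcs U s (X ∩ Y)).indicator 1) *
          prob p (REventC arcs U s (X ∪ Y)) :=
  bhkC_induced' p hp hS s (fun _ _ h => hF₁ h) (fun _ _ h => hF₂ h) (fun _ => hF₁0 _)
    (fun _ => hF₂0 _) U

/-- **Directed BHK 1.3 for cluster functionals on the whole coin system** (`SameEnds`): for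
nonnegative monotone `F₁, F₂` and avoided sets `X, Y`,
`E(F₁(S⁺) 1_{R_X}) · E(F₂(S⁺) 1_{R_Y}) ≤ E((F₁F₂)(S⁺) 1_{R_{X∩Y}}) · P(R_{X∪Y})`, with
`S⁺ = clusterC arcs ω s` and `R_X = avoidEvent arcs s X`. -/
theorem bhkC (p : E → R) (hp : IsProbVec p) {arcs : E → Finset (V × V)} (hS : SameEnds arcs)
    (s : V) {F₁ F₂ : Set V → R} (hF₁ : Monotone F₁) (hF₂ : Monotone F₂)
    (hF₁0 : ∀ S, 0 ≤ F₁ S) (hF₂0 : ∀ S, 0 ≤ F₂ S) (X Y : Finset V) :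
    expect p ((fun ω => F₁ (clusterC arcs ω s)) * (avoidEvent arcs s X).indicator 1) *
        expect p ((fun ω => F₂ (clusterC arcs ω s)) * (avoidEvent arcs s Y).indicator 1) ≤
      expect p ((fun ω => (F₁ * F₂) (clusterC arcs ω s)) *
          (avoidEvent arcs s (X ∩ Y)).indicator 1) *
        prob p (avoidEvent arcs s (X ∪ Y)) := by
  have h := bhkC_induced p hp hS s hF₁ hF₂ hF₁0 hF₂0 Finset.univ X Y (Finset.subset_univ X)
    (Finset.subset_univ Y)
  have e : ∀ F : Set V → R, clusterObsC arcs Finset.univ s F = fun ω => F (clusterC arcs ω s) := by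
    intro F; funext ω; simp only [clusterObsC_apply, clusterInC_univ]
  simpa only [REventC_univ, e] using h

end BHKMain

end Summit.Ventures.PercRepro2.Coin
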